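import Summits.CriticalPhenomena.CardyFormulaZ2.Theorems.CardyBoundaryCoulombGasRectilinearCardyRowDefs
import HarnessLib

/-!
# Closure-discretised PERCOLATION objects of the line `excursion-kernel-covariance`
# (crux `RectilinearCardy`, stmt-CriticalPhenomena-5660, route `CardyBoundaryCoulombGas`)

Third DEFINITIONS MODULE of the line (continuation lead `prover-line-stmt-CriticalPhenomena-5660-c2-0`,
2026-08-16, reshape c2-1 of the skeleton `Cruxes/RectilinearCardy/Lines/excursion_kernel_covariance.lean`).
The first two modules (`…RectilinearCardyDefs`, p95886; `…RectilinearCardyRowDefs`, p117931) put the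
percolation tail `tailCrossingProb` on Smirnov's OPEN mesh discretisation and the random-walk objects on
the CLOSURE discretisation `V_δ = {v : δ v ∈ Ω̄}` (`closureFinset`, `boundaryRow`, `rowTail`). Reshape
c2-1 re-bases the PERCOLATION side on the closure discretisation too — the vertex set, boundary row and
induced edges of the route's engine crux `BoundaryDefectGaussianR` (stmt-14132: `V n ↔ closure D.carrier`,
insertion points = boundary-row vertices, Baxter–Kelland–Wu collar on the induced edges) — so that the
line's lever can be typed as a LOCAL DENSITY LAW fed by the engine's `(1,1,1;3)` member through the BKW
rainbow dictionary, with no mesh/closure mismatch: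

* `rowArc R δ` — boundary-row vertices attributed to the arc `(ab) = R.arc 0` by Smirnov's closest-arc
  rule (the `boundaryRow` analogue of `discreteArc`, companion of `rowTail`);
* `closureTailProb R δ s` — `Q^cl_δ(s)`: the `P_{1/2}`-probability of an open path of `V_δ` (induced
  bond percolation on `ℤ²`, tree `openCrossing`/`openConnIn`) from `rowArc` to `rowTail s`; the tail
  distribution function of the `d`-most boundary-row vertex joined to `(ab)`; `closureCrossingProb R δ`
  is its value at `s = mark 2` (tail arc `= R.arc 2`, `arc_two_eq_tailArc`);
* `rowBeyond R δ v` — the boundary-row vertices lying in every tail containing `v` (other than `v`): on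
  a flat window, the vertices strictly after `v` towards `d` (`kwl_mem_rowTail_iff`);
* `closureDensity R δ v` — `P_{1/2}[{v ↔ rowArc} ∖ {rowBeyond v ↔ rowArc}]`, the probability that `v`
  is the `d`-most boundary-row vertex joined to `(ab)` — the percolation reading of the `(1,1,1;3)`
  rainbow event of the BKW dictionary (sources `a, b, d`, sink next to `v`);
* `densityMass R δ s = Σ_{v ∈ rowTail s} closureDensity v` — the bookkeeping twin of `rowMass` (p117931)
  with the cube-root weight replaced by the density, so that the landed Riemann-sum machinery of
  `stub_kernelWindowLaw` (`kwl_*`) applies verbatim.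

Nothing is asserted here beyond bookkeeping lemmas (monotonicity, bounds, the window-sum identity).
Sources: Smirnov 2001 §2 (closest-arc rule); Baxter–Kelland–Wu 1976 (collar on induced edges); the line
card `Cruxes/RectilinearCardy/Lines/excursion-kernel-covariance.md`; lead notes `Cruxes/RectilinearCardy/PICKED.md`.
-/

noncomputable section

open Set Filter Topology MeasureTheory
open Literature.Probability.RandomPlanarGeometry
open Literature.Probability.Percolation (bondPercolation half openCrossing openConnIn)
open Literature.Probability.LatticeModels (Site meshPoint zdGraph)

namespace Summit.CriticalPhenomena.CardyFormulaZ2.Cruxes.RectilinearCardy.ExcursionKernelCovariance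

/-! ### The objects -/

/-- Boundary-row vertices of `V_δ` attributed to the arc `(ab) = R.arc 0` by Smirnov's closest-arc rule
(companion of `rowTail`; the lattice realisation of the wired source arc `[a, b]` of the `(1,1,1;3)`
collar, up to convex-corner vertices, which carry no connectivity). [cite: Smirnov2001, §2] -/
def rowArc (R : ConformalRectangle) (δ : ℝ) : Finset (Site 2) :=
  (boundaryRow R δ).filter fun v =>
    Metric.infDist (meshPoint δ v) (R.arc 0) ≤ Metric.infDist (meshPoint δ v) (frontier R.carrier \ R.arc 0)

/-- THE CLOSURE TAIL `Q^cl_δ(s)`: the `P_{1/2}`-probability (bond percolation on `ℤ²`) of an open path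
with all vertices in `V_δ` from `rowArc` to `rowTail s` — the closure-discretised law of the `d`-most
boundary-row vertex joined to `(ab)`, as a tail function of the boundary parameter. [folklore] -/
def closureTailProb (R : ConformalRectangle) (δ s : ℝ) : ℝ :=
  (bondPercolation (zdGraph 2) half).real
    (openCrossing (↑(closureFinset R δ) : Set (Site 2)) ↑(rowArc R δ) ↑(rowTail R δ s))

/-- The crux's crossing probability in the CLOSURE discretisation: `Q^cl_δ(mark 2)` (the tail arc from
`mark 2` is `R.arc 2`). [folklore] -/
def closureCrossingProb (R : ConformalRectangle) (δ : ℝ) : ℝ :=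
  closureTailProb R δ (R.mark 2)

open Classical in
/-- The boundary-row vertices BEYOND `v` (towards `d`): those, other than `v`, lying in every tail
`rowTail s`, `s ∈ [mark 1, mark 3]`, that contains `v`. On a flat window these are exactly the row
vertices whose foot parameter exceeds that of `v` (`kwl_mem_rowTail_iff`). [folklore] -/
def rowBeyond (R : ConformalRectangle) (δ : ℝ) (v : Site 2) : Finset (Site 2) :=
  (boundaryRow R δ).filter fun w =>
    w ≠ v ∧ ∀ s ∈ Icc (R.mark 1) (R.mark 3), v ∈ rowTail R δ s → w ∈ rowTail R δ s

/-- THE CLOSURE DENSITY `d_δ(v) = P_{1/2}[{v ↔ rowArc in V_δ} ∖ {rowBeyond v ↔ rowArc in V_δ}]`: the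
probability that `v` is the `d`-most boundary-row vertex joined to `(ab)` — the percolation side of the
`(1,1,1;3)` rainbow event of the Baxter–Kelland–Wu dictionary. [cite: BaxterKellandWu1976, §3–§4] -/
def closureDensity (R : ConformalRectangle) (δ : ℝ) (v : Site 2) : ℝ :=
  (bondPercolation (zdGraph 2) half).real
    (openCrossing (↑(closureFinset R δ) : Set (Site 2)) ↑(rowArc R δ) {v} \
      openCrossing (↑(closureFinset R δ) : Set (Site 2)) ↑(rowArc R δ) ↑(rowBeyond R δ v))

/-- The DENSITY MASS of the tail: `Σ_{v ∈ rowTail s} d_δ(v)` (twin of `rowMass` with the cube-root weight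
replaced by the closure density; on flat windows its increments are those of `Q^cl_δ`). [folklore] -/
def densityMass (R : ConformalRectangle) (δ s : ℝ) : ℝ :=
  ∑ v ∈ rowTail R δ s, closureDensity R δ v

/-! ### Proved bookkeeping -/

/-- Membership in `rowArc`, unfolded. [folklore] -/
theorem mem_rowArc_iff (R : ConformalRectangle) {δ : ℝ} {v : Site 2} :
    v ∈ rowArc R δ ↔ v ∈ boundaryRow R δ ∧
      Metric.infDist (meshPoint δ v) (R.arc 0) ≤
        Metric.infDist (meshPoint δ v) (frontier R.carrier \ R.arc 0) := by
  unfold rowArc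
  rw [Finset.mem_filter]

/-- `rowArc` lies in the boundary row. [folklore] -/
theorem rowArc_subset (R : ConformalRectangle) (δ : ℝ) : rowArc R δ ⊆ boundaryRow R δ :=
  Finset.filter_subset _ _

/-- Membership in `rowBeyond`, unfolded. [folklore] -/
theorem mem_rowBeyond_iff (R : ConformalRectangle) {δ : ℝ} {v w : Site 2} :
    w ∈ rowBeyond R δ v ↔ w ∈ boundaryRow R δ ∧ w ≠ v ∧
      ∀ s ∈ Icc (R.mark 1) (R.mark 3), v ∈ rowTail R δ s → w ∈ rowTail R δ s := by
  classical
  simp only [rowBeyond, Finset.mem_filter]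

/-- `rowBeyond v` lies in the boundary row. [folklore] -/
theorem rowBeyond_subset (R : ConformalRectangle) (δ : ℝ) (v : Site 2) :
    rowBeyond R δ v ⊆ boundaryRow R δ :=
  fun _ hw => ((mem_rowBeyond_iff R).1 hw).1

/-- `v ∉ rowBeyond v`. [folklore] -/
theorem not_mem_rowBeyond_self (R : ConformalRectangle) (δ : ℝ) (v : Site 2) : v ∉ rowBeyond R δ v := by
  rw [mem_rowBeyond_iff]
  exact fun h => h.2.1 rfl

/-- `rowBeyond v` lies in every tail containing `v`. [folklore] -/
theorem rowBeyond_subset_rowTail (R : ConformalRectangle) {δ s : ℝ} {v : Site 2}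
    (hs : s ∈ Icc (R.mark 1) (R.mark 3)) (hv : v ∈ rowTail R δ s) : rowBeyond R δ v ⊆ rowTail R δ s :=
  fun _ hw => ((mem_rowBeyond_iff R).1 hw).2.2 s hs hv

/-- Open crossing events are monotone in the target set. [folklore] -/
theorem openCrossing_mono_target {V : Type*} (S A : Set V) {B B' : Set V} (h : B ⊆ B') :
    openCrossing S A B ⊆ openCrossing S A B' := by
  rintro ω ⟨x, hx, y, hy, hω⟩
  exact ⟨x, hx, y, h hy, hω⟩

/-- `Q^cl_δ(s) ∈ [0, 1]`. [folklore] -/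
theorem closureTailProb_mem_Icc (R : ConformalRectangle) (δ s : ℝ) :
    closureTailProb R δ s ∈ Icc (0 : ℝ) 1 :=
  ⟨measureReal_nonneg, measureReal_le_one⟩

/-- **`Q^cl_δ` is a tail function**: non-increasing in `s` on `[mark 1, mark 3]` (`rowTail_mono` and
monotonicity of the crossing event in its target). [folklore] -/
theorem closureTailProb_antitone (R : ConformalRectangle) (δ : ℝ) {s s' : ℝ} (h1 : R.mark 1 ≤ s)
    (hss' : s ≤ s') (h3 : s' ≤ R.mark 3) : closureTailProb R δ s' ≤ closureTailProb R δ s := by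
  unfold closureTailProb
  refine measureReal_mono ?_ (measure_ne_top _ _)
  exact openCrossing_mono_target _ _ (Finset.coe_subset.2 (rowTail_mono R δ h1 hss' h3))

/-- `Q^cl_δ` is antitone on `[mark 1, mark 3]`, as an `AntitoneOn` statement. [folklore] -/
theorem closureTailProb_antitoneOn (R : ConformalRectangle) (δ : ℝ) :
    AntitoneOn (closureTailProb R δ) (Icc (R.mark 1) (R.mark 3)) :=
  fun _ ha _ hb hab => closureTailProb_antitone R δ ha.1 hab hb.2

/-- **The evaluation point is the closure crossing probability**: `Q^cl_δ(mark 2) = closureCrossingProb R δ`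
(by definition). [folklore] -/
theorem closureTailProb_mark_two (R : ConformalRectangle) (δ : ℝ) :
    closureTailProb R δ (R.mark 2) = closureCrossingProb R δ := rfl

/-- The target of `closureCrossingProb` is the row attributed to the arc `(cd) = R.arc 2`. [folklore] -/
theorem closureCrossingProb_eq (R : ConformalRectangle) (δ : ℝ) :
    closureCrossingProb R δ = (bondPercolation (zdGraph 2) half).real
      (openCrossing (↑(closureFinset R δ) : Set (Site 2)) ↑(rowArc R δ) ↑(rowTail R δ (R.mark 2))) := rfl

/-- `d_δ(v) ∈ [0, 1]`. [folklore] -/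
theorem closureDensity_mem_Icc (R : ConformalRectangle) (δ : ℝ) (v : Site 2) :
    closureDensity R δ v ∈ Icc (0 : ℝ) 1 :=
  ⟨measureReal_nonneg, measureReal_le_one⟩

/-- `d_δ(v) ≥ 0`. [folklore] -/
theorem closureDensity_nonneg (R : ConformalRectangle) (δ : ℝ) (v : Site 2) : 0 ≤ closureDensity R δ v :=
  measureReal_nonneg

/-- `densityMass` is non-negative. [folklore] -/
theorem densityMass_nonneg (R : ConformalRectangle) (δ s : ℝ) : 0 ≤ densityMass R δ s :=
  Finset.sum_nonneg fun v _ => closureDensity_nonneg R δ v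

/-- **`densityMass` is non-increasing in `s`** on `[mark 1, mark 3]`. [folklore] -/
theorem densityMass_antitone (R : ConformalRectangle) (δ : ℝ) {s s' : ℝ} (h1 : R.mark 1 ≤ s)
    (hss' : s ≤ s') (h3 : s' ≤ R.mark 3) : densityMass R δ s' ≤ densityMass R δ s :=
  Finset.sum_le_sum_of_subset_of_nonneg (rowTail_mono R δ h1 hss' h3)
    fun v _ _ => closureDensity_nonneg R δ v

/-- The window density mass `densityMass s - densityMass s'` is the sum of the densities over the row
vertices attributed to `∂Ω[s, d]` but not to `∂Ω[s', d]` (twin of `rowMass_sub_eq_sum_sdiff`). [folklore] -/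
theorem densityMass_sub_eq_sum_sdiff (R : ConformalRectangle) (δ : ℝ) {s s' : ℝ} (h1 : R.mark 1 ≤ s)
    (hss' : s ≤ s') (h3 : s' ≤ R.mark 3) :
    densityMass R δ s - densityMass R δ s' =
      ∑ v ∈ rowTail R δ s \ rowTail R δ s', closureDensity R δ v := by
  unfold densityMass
  rw [← Finset.sum_sdiff (rowTail_mono R δ h1 hss' h3), add_sub_cancel_right]

end Summit.CriticalPhenomena.CardyFormulaZ2.Cruxes.RectilinearCardy.ExcursionKernelCovariance

end
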